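import Summits.ResolutionOfSingularities.ResolutionOfSingularities.Theorems.EquisingularLiftEquisingularLiftNatEmbeddedInfinitesimalLift
import Summits.ResolutionOfSingularities.ResolutionOfSingularities.Theorems.EquisingularLiftEquisingularLiftNatEmbeddedLiftTwist
import Summits.ResolutionOfSingularities.ResolutionOfSingularities.Theorems.EquisingularLiftEquisingularLiftNatLiftOfIdealSheafData
import Summits.ResolutionOfSingularities.ResolutionOfSingularities.Theorems.EquisingularLiftEquisingularLiftNatEmbeddedLiftOfInfinitesimal
import HarnessLib

/-!
# [OURS · L1 W4.5(b) · EL♮(3) · WIDTH TABLE D8 «NODAL HOSTED ROUND (HR-KEEP-N)», support debt S-D8-LIFT, part 4, brick (N-C0)]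
# THE TWISTED FIRST-ORDER FAMILY — `exists_firstOrder_lift_twist_family`

res-L1-w45b-stub-2 g19 (STUB WORKER 2; brick offered to the plan owner res-L1-w45b-stub-4 g14 on the cell bus 2026-08-29T04:48Z, under the split of
record 2026-08-29T04:20:51Z).  OURS; NOT a statement of any manuscript ([Hironaka2017] is a candidate under adjudication, D-0012/D-0089 — nothing of
it is asserted here); AI-written, weaker than expert review.  No `sorry`; standard axioms; DEF-FREE.  `--supports stmt-ResolutionOfSingularities-20148
--as helper`, counted 0.  EL♮(3) is NOT proved; resolution of singularities in positive characteristic is NOT proved.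

WHAT.  In the currency of F-88's (F) (✓ `EmbeddedLiftFact`, binders VERBATIM as in ✓ (N-C4) `exists_flat_lift_of_firstOrder`, minus Grothendieck
existence and adic completeness, which are not needed at first order; plus an arbitrary proof `hI : 𝔪 ≤ ker θ` and a uniformizer `ϖ`, so that the
chart currency of the patching engine (π) can be NAMED in the conclusion):
* `exists_affine_hasLciTrace` — every point of `W_{n+1}` has an affine chart whose trace chart carries weakly regular generators of `𝓘_{Y₀}`
  (`HasLciTrace`), from the pointwise lci clause `hlci` alone (J1's chart argument ✓ `embeddedInfinitesimalLiftFact_holds`, without the lifts).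
* ★ `exists_firstOrder_lift_twist_family` — there is ONE first-order lift `G` of `Y₀ ↪ W₀` to `W₁ = W ×_O O/𝔪²` (an ideal sheaf with
  `G·𝒪_{W_0} = 𝓘_{Y₀}` and `V(G) → Spec O/𝔪²` flat: J1 ✓ `embeddedInfinitesimalLiftFact_holds` at `n = 0` started from `Y₀` itself), and for EVERY
  global section `ψ` of the normal sheaf `𝒩` of `ι : Y₀ ↪ W₀` its TWIST `Gψ` ((C3) ✓ `exists_idealSheafData_twist`), again a flat first-order lift
  of `Y₀`, delivered with (i) the restriction square `Y₀ = V(Gψ) ×_W W₀` in the exact shape of (N-C4)'s hypothesis `hres₁` (so that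
  `exists_flat_lift_of_firstOrder … Gψ.subscheme Gψ.subschemeι` algebraises it), and (ii) on every affine chart `U` of `W₁` with an lci trace, the
  difference section of the two chart lifts `(G(U), Gψ(U))` IS `ψ|` (F5 `IsDiffSec`, base element `ε = ϖ̄`), which is what the node analysis (C5) of the
  plan owner reads.  The (π)-currency is kept at `n = 0` VERBATIM (`0 + 1`, `ϖ ^ (0 + 1)`), so that instances of the (π)/(C3)/(C5) lemmas at `n := 0`
  match by token.
USE (part 4 (C6), res-L1-w45b-stub-4): `ψ := c • ψ_{N4}` for `c ∈ k = k̄`; at each of the finitely many non-regular points of `Z̃` at most one `c` is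
bad ((C5-b)), so some twist algebraises ((N-C4)) to a lift with REGULAR total space ((C5-d) at the nodes, (N-C2′) elsewhere).
References (method / index only): R. Hartshorne, *Deformation Theory*, GTM 257 (2010), Thm. 6.2 (a)/(b), Thm. 9.2 (b), proof of Thm. 22.3.
-/

set_option linter.dupNamespace false -- mandated namespace `Summit.<Summit>.<Problem>` of this single-conjunct summit
-- `TopCat.Presheaf`/`Scheme.Modules` are not reducible (as in Mathlib's `AlgebraicGeometry/Modules` and the tree's `Modules/*`).
set_option backward.isDefEq.respectTransparency false

noncomputable section

open CategoryTheory CategoryTheory.Limits AlgebraicGeometry Opposite TopologicalSpace IsLocalRing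
open Literature.AlgebraicGeometry.Morphisms Literature.AlgebraicGeometry.Modules Literature.AlgebraicGeometry.Deformation
open Literature.AlgebraicGeometry.HodgeTheory
open AlgebraicGeometry.Scheme.IdealSheafData

namespace Summit.ResolutionOfSingularities.ResolutionOfSingularities.Cruxes.EquisingularLiftNat.Sections

/-! ## Charts with an lci trace at every point of `W_{n+1}` -/

section Charts

variable {O : Type} [CommRing O] [IsDomain O] [IsDiscreteValuationRing O] {k : Type} [Field k] {θ : O →+* k}
  (hθ : Function.Surjective θ) (hI : maximalIdeal O ≤ RingHom.ker θ)
  {W : Scheme.{0}} {w : W ⟶ Spec (.of O)} {W₀ : Scheme.{0}} {jW : W₀ ⟶ W} {tW : W₀ ⟶ Spec (.of k)}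
  (hsq : IsPullback jW tW w (Spec.map (CommRingCat.ofHom θ)))
  {Y₀ : Scheme.{0}} (ι : Y₀ ⟶ W₀) [IsClosedImmersion ι]

/-- **Every point of `W_{n+1}` has an affine chart with an lci trace.**  From the pointwise lci clause of (F)/J1 (`hlci`: around `ι z` an affine
`Uz ⊆ W₀` on which `𝓘_{Y₀}` is generated by a weakly regular sequence): a point over `ι z` has an affine chart inside `W₁ ∖ e(W₀ ∖ Uz)`, whose trace
chart lies in `Uz` (B3 ✓ `exists_isWeaklyRegular_generators_of_le`); a point off the image of `Y₀` has an affine chart missing it, where the trace of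
`𝓘_{Y₀}` is the unit ideal (`[1]` is weakly regular).  This is the chart half of J1's proof (✓ `embeddedInfinitesimalLiftFact_holds`), without the
lifts. [OURS · (π) plumbing · folklore] -/
theorem exists_affine_hasLciTrace
    (hlci : ∀ z : Y₀, ∃ U : W₀.affineOpens, ι.base z ∈ (U : W₀.Opens) ∧
      ∃ rs : List Γ(W₀, U), RingTheory.Sequence.IsWeaklyRegular Γ(W₀, U) rs ∧ Ideal.ofList rs = ι.ker.ideal U)
    (n : ℕ) (x : infinitesimalNeighbourhood (maximalIdeal O) w (n + 1)) :
    ∃ U : (infinitesimalNeighbourhood (maximalIdeal O) w (n + 1)).affineOpens,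
      x ∈ (U : (infinitesimalNeighbourhood (maximalIdeal O) w (n + 1)).Opens) ∧ HasLciTrace (maximalIdeal O) w n θ hθ hI hsq ι U := by
  have hker : RingHom.ker θ = maximalIdeal O := ker_eq_maximalIdeal_of_surjective θ hθ
  have hI' : RingHom.ker θ ≤ maximalIdeal O := hker.le
  haveI hfE : IsClosedImmersion (fibreEmb (maximalIdeal O) w θ hI hsq n) := isClosedImmersion_fibreEmb _ w θ hI hsq hθ n
  haveI hfE' : IsClosedImmersion (fibreEmb (maximalIdeal O) w θ hI hsq (n + 1)) := isClosedImmersion_fibreEmb _ w θ hI hsq hθ (n + 1)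
  haveI ht : IsClosedImmersion (infinitesimalNeighbourhood.transition (maximalIdeal O) w n) := isClosedImmersion_transition _ w n
  haveI : Surjective (fibreEmb (maximalIdeal O) w θ hI hsq (n + 1)) := surjective_fibreEmb _ w θ hI hsq hθ hI' (n + 1)
  have hpre : ∀ U : (infinitesimalNeighbourhood (maximalIdeal O) w (n + 1)).Opens,
      fibreEmb (maximalIdeal O) w θ hI hsq n ⁻¹ᵁ ((infinitesimalNeighbourhood.transition (maximalIdeal O) w n) ⁻¹ᵁ U) =
        fibreEmb (maximalIdeal O) w θ hI hsq (n + 1) ⁻¹ᵁ U := fun U => by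
    rw [← Scheme.Hom.comp_preimage, fibreEmb_transition]
  have hpt : ∀ x₀ : W₀, (infinitesimalNeighbourhood.transition (maximalIdeal O) w n).base ((fibreEmb (maximalIdeal O) w θ hI hsq n).base x₀) =
      (fibreEmb (maximalIdeal O) w θ hI hsq (n + 1)).base x₀ := fun x₀ => by
    rw [← Scheme.Hom.comp_apply, fibreEmb_transition]
  obtain ⟨x₀, rfl⟩ := (fibreEmb (maximalIdeal O) w θ hI hsq (n + 1)).surjective x
  by_cases hx₀ : x₀ ∈ Set.range ι.base
  · -- over a point of `Y₀`: an affine chart inside `W_{n+1} ∖ e(W₀ ∖ Uz)`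
    obtain ⟨z, rfl⟩ := hx₀
    obtain ⟨Uz, hzU, hUz⟩ := hlci z
    have hxN : (fibreEmb (maximalIdeal O) w θ hI hsq (n + 1)).base (ι.base z) ∈
        complOpens (fibreEmb (maximalIdeal O) w θ hI hsq (n + 1)) (Uz : W₀.Opens) := base_mem_complOpens _ hzU
    obtain ⟨U, hU, hxU, hUN⟩ := exists_isAffineOpen_mem_and_subset hxN
    refine ⟨⟨U, hU⟩, hxU, ?_⟩
    have hle : (traceChart (maximalIdeal O) w n θ hθ hI hsq ⟨U, hU⟩ : W₀.Opens) ≤ Uz := by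
      rw [coe_traceChart, hpre, ← preimage_complOpens (fibreEmb (maximalIdeal O) w θ hI hsq (n + 1)) (Uz : W₀.Opens)]
      exact (fibreEmb (maximalIdeal O) w θ hI hsq (n + 1)).preimage_mono hUN
    exact exists_fin_of_list
      (exists_isWeaklyRegular_generators_of_le ι.ker (U := traceChart (maximalIdeal O) w n θ hθ hI hsq ⟨U, hU⟩) hle hUz)
  · -- off `Y₀`: a chart missing the image of `Y₀`, where the trace ideal is the unit ideal
    set e := ι ≫ fibreEmb (maximalIdeal O) w θ hI hsq (n + 1) with he
    have hx : (fibreEmb (maximalIdeal O) w θ hI hsq (n + 1)).base x₀ ∉ Set.range e.base := by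
      rintro ⟨y, hy⟩
      rw [he, Scheme.Hom.comp_apply] at hy
      exact hx₀ ⟨y, (fibreEmb (maximalIdeal O) w θ hI hsq (n + 1)).isClosedEmbedding.injective hy⟩
    have hxN := mem_complOpens_of_not_mem_range e ⊥ hx
    obtain ⟨U, hU, hxU, hUN⟩ := exists_isAffineOpen_mem_and_subset hxN
    have hempty : ∀ y : Y₀, e.base y ∉ U := fun y hy => by
      have h := hUN hy
      rw [SetLike.mem_coe, mem_complOpens_iff] at h
      exact h ⟨y, fun h' => h', rfl⟩
    have htrace : ι ⁻¹ᵁ (traceChart (maximalIdeal O) w n θ hθ hI hsq ⟨U, hU⟩ : W₀.Opens) = ⊥ := by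
      refine le_bot_iff.mp fun y hy => hempty y ?_
      rw [he, Scheme.Hom.comp_apply, ← hpt]
      exact hy
    refine ⟨⟨U, hU⟩, hxU, ?_⟩
    haveI := subsingleton_sections_of_eq_bot htrace
    refine exists_fin_of_eq_top ?_
    rw [Scheme.Hom.ker_apply]
    exact ker_eq_top_of_subsingleton _

end Charts

/-! ## The twisted first-order family -/

/-- ★ **(N-C0) THE TWISTED FIRST-ORDER FAMILY.**  Under F-88's (F) hypotheses (`EmbeddedLiftFact`'s binders verbatim: `O` a DVR with `θ : O ↠ k`,
`w : W → Spec O` proper flat with model square `(jW, tW)`, `ι : Y₀ ↪ W₀` closed lci with `Ȟ¹(𝒩) = 0`), for any proof `hI : 𝔪 ≤ ker θ` and any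
uniformizer `ϖ`: there is a first-order lift `G` of `Y₀` to `W₁` — `G.comap (transition 0) = 𝓘_{Y₀ ↪ W_0}`, `V(G) → Spec O/𝔪²` flat — and, for every
global normal section `ψ ∈ Γ(Y₀, 𝒩)`, a twist `Gψ` with the same two clauses, the restriction square `∃ s₀, IsPullback s₀ ι (Gψ.subschemeι ≫ ι₁) jW`
((N-C4)'s `hres₁` for `Y₁ := V(Gψ)`, `j₁ := Gψ.subschemeι`), and, on every affine chart `U` of `W₁` with an lci trace,
`IsDiffSec ι ϖ̄ (traceHom U) (G(U)) (Gψ(U)) (ψ|)`.  Proof: J1 ✓ `embeddedInfinitesimalLiftFact_holds` at `n = 0` from `Y₀` itself (kernel form (γ♯)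
✓ `ker_comap_eq_of_isPullback`), (C3) ✓ `exists_idealSheafData_twist` with the base data `ε = ϖ̄`, `ann ε = 𝔪/𝔪²` (✓ `Levels.*`), the charts of
`exists_affine_hasLciTrace`, and the square by pasting `Y₀ = Y₀ ×_{W_0} W_0`, `Y₀ = V(Gψ) ×_{W₁} W_0` (Mathlib `isPullback_of_isClosedImmersion`)
and `V(Gψ) = V(Gψ) ×_W W₁` along `jW = e₀ ≫ t₀ ≫ ι₁`.
[cite: Hartshorne2010, Thm. 6.2 (a)/(b) (proof pp. 47–49)] [OURS · L1 W4.5b · WIDTH TABLE D8, support debt S-D8-LIFT, brick (N-C0); counted 0] -/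
theorem exists_firstOrder_lift_twist_family
    (O : Type) [CommRing O] [IsDomain O] [IsDiscreteValuationRing O]
    (k : Type) [Field k] (θ : O →+* k) (hθ : Function.Surjective θ) (hI : maximalIdeal O ≤ RingHom.ker θ)
    (ϖ : O) (hϖ : Irreducible ϖ)
    (W : Scheme.{0}) (w : W ⟶ Spec (.of O)) (W₀ : Scheme.{0}) (jW : W₀ ⟶ W) (tW : W₀ ⟶ Spec (.of k))
    (hsq : IsPullback jW tW w (Spec.map (CommRingCat.ofHom θ))) (hprop : IsProper w) (hflat : Flat w)
    (Y₀ : Scheme.{0}) (ι : Y₀ ⟶ W₀) (hι : IsClosedImmersion ι)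
    (hlci : ∀ z : Y₀, ∃ U : W₀.affineOpens, ι.base z ∈ (U : W₀.Opens) ∧
      ∃ rs : List Γ(W₀, U), RingTheory.Sequence.IsWeaklyRegular Γ(W₀, U) rs ∧ Ideal.ofList rs = ι.ker.ideal U)
    (hH1 : ∃ V : Fin 2 → Y₀.Opens, (∀ j, IsAffineOpen (V j)) ∧ IsAffineOpen (V 0 ⊓ V 1) ∧ ⨆ j, V j = ⊤ ∧
      Subsingleton (CechMH1 Y₀.toSpecΓ (normalSheaf ι) V)) :
    ∃ G : (infinitesimalNeighbourhood (maximalIdeal O) w (0 + 1)).IdealSheafData,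
      G.comap (infinitesimalNeighbourhood.transition (maximalIdeal O) w 0) = (ι ≫ fibreEmb (maximalIdeal O) w θ hI hsq 0).ker ∧
      Flat (G.subschemeι ≫ infinitesimalNeighbourhood.toSpec (maximalIdeal O) w (0 + 1)) ∧
      ∀ ψ : Γ(normalSheaf ι, ⊤), ∃ G' : (infinitesimalNeighbourhood (maximalIdeal O) w (0 + 1)).IdealSheafData,
        G'.comap (infinitesimalNeighbourhood.transition (maximalIdeal O) w 0) = (ι ≫ fibreEmb (maximalIdeal O) w θ hI hsq 0).ker ∧
        Flat (G'.subschemeι ≫ infinitesimalNeighbourhood.toSpec (maximalIdeal O) w (0 + 1)) ∧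
        (∃ s₀ : Y₀ ⟶ G'.subscheme,
          IsPullback s₀ ι (G'.subschemeι ≫ infinitesimalNeighbourhood.ι (maximalIdeal O) w (0 + 1)) jW) ∧
        ∀ U : (infinitesimalNeighbourhood (maximalIdeal O) w (0 + 1)).affineOpens,
          HasLciTrace (maximalIdeal O) w 0 θ hθ hI hsq ι U →
            letI := chartAlg (maximalIdeal O) w (0 + 1) U
            IsDiffSec ι (Ideal.Quotient.mk (maximalIdeal O ^ (0 + 1 + 1)) (ϖ ^ (0 + 1)))
              (traceHom (maximalIdeal O) w 0 θ hI hsq U) (G.ideal U) (G'.ideal U)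
              (MSections.res Y₀.toSpecΓ (normalSheaf ι)
                (le_top : ι ⁻¹ᵁ (traceChart (maximalIdeal O) w 0 θ hθ hI hsq U : W₀.Opens) ≤ ⊤) ψ) := by
  haveI := hι
  haveI := hflat
  haveI := hprop
  have hker : RingHom.ker θ = maximalIdeal O := ker_eq_maximalIdeal_of_surjective θ hθ
  -- the base data of the small extensions `O/𝔪ⁿ⁺² ↠ O/𝔪ⁿ⁺¹`: `ε = ϖ̄ⁿ⁺¹`, `ann ε = 𝔪 ∋ ε`, nilpotent (kept at a VARIABLE level `n` and
  -- specialised to `n := 0` only by application: an ascribed type mixing `𝔪 ^ (0 + 2)` with `𝔪 ^ (0 + 1 + 1)` makes `whnf` unfold the powers)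
  have hkert : ∀ n : ℕ, RingHom.ker (infinitesimalNeighbourhood.transitionRingHom (maximalIdeal O) n) =
      Ideal.span {Ideal.Quotient.mk (maximalIdeal O ^ (n + 1 + 1)) (ϖ ^ (n + 1))} := fun n =>
    (Levels.ker_factor_eq_map_pow (O := O) (n + 1)).trans (Levels.map_pow_eq_span_mk_pow hϖ (n + 1))
  have hann : ∀ (n : ℕ) (c : O ⧸ maximalIdeal O ^ (n + 1 + 1)), Ideal.Quotient.mk (maximalIdeal O ^ (n + 1 + 1)) (ϖ ^ (n + 1)) * c = 0 ↔
      c ∈ (RingHom.ker θ).map (Ideal.Quotient.mk (maximalIdeal O ^ (n + 1 + 1))) := fun n c => by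
    rw [hker]; exact Levels.mk_pow_mul_eq_zero_iff hϖ (n + 1) c
  have hεm : ∀ n : ℕ, Ideal.Quotient.mk (maximalIdeal O ^ (n + 1 + 1)) (ϖ ^ (n + 1)) ∈
      (RingHom.ker θ).map (Ideal.Quotient.mk (maximalIdeal O ^ (n + 1 + 1))) := fun n => by
    rw [hker]; exact Levels.mk_pow_succ_mem_map hϖ (n + 1) n
  have hnil : ∀ n : ℕ, IsNilpotent ((RingHom.ker θ).map (Ideal.Quotient.mk (maximalIdeal O ^ (n + 1 + 1)))) := fun n => by
    rw [hker]; exact Levels.isNilpotent_map_maximalIdeal (n + 1)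
  -- `W₀` is locally Noetherian (locally of finite type over the field `k`)
  haveI : LocallyOfFiniteType tW := MorphismProperty.of_isPullback hsq (inferInstance : LocallyOfFiniteType w)
  haveI : IsLocallyNoetherian W₀ := LocallyOfFiniteType.isLocallyNoetherian tW
  -- the closed immersions around
  haveI hfE0 : IsClosedImmersion (fibreEmb (maximalIdeal O) w θ hI hsq 0) := isClosedImmersion_fibreEmb _ w θ hI hsq hθ 0
  haveI hfE1 : IsClosedImmersion (fibreEmb (maximalIdeal O) w θ hI hsq (0 + 1)) := isClosedImmersion_fibreEmb _ w θ hI hsq hθ (0 + 1)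
  haveI ht : IsClosedImmersion (infinitesimalNeighbourhood.transition (maximalIdeal O) w 0) := isClosedImmersion_transition _ w 0
  haveI hjW : IsClosedImmersion jW := MorphismProperty.of_isPullback hsq.flip (IsClosedImmersion.spec_of_surjective _ hθ)
  -- level 0: `Y₀` itself, `jn := ι ≫ e₀`
  have hs₀ : IsPullback (𝟙 Y₀) ι
      ((ι ≫ fibreEmb (maximalIdeal O) w θ hI hsq 0) ≫ infinitesimalNeighbourhood.ι (maximalIdeal O) w 0) jW := by
    rw [Category.assoc, fibreEmb_ι]
    exact isPullback_id_of_mono ι jW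
  have hflat0 : Flat ((ι ≫ fibreEmb (maximalIdeal O) w θ hI hsq 0) ≫ infinitesimalNeighbourhood.toSpec (maximalIdeal O) w 0) := by
    rw [Category.assoc, fibreEmb_toSpec, ← Category.assoc]
    have hbij : Function.Bijective (fibreRingHom (maximalIdeal O) θ hI 0) := by
      refine ⟨RingHom.lift_injective_of_ker_le_ideal _ (fun a ha => hI (Ideal.pow_le_self (Nat.succ_ne_zero 0) ha)) ?_,
        fun b => ?_⟩
      · rw [pow_one]; exact (IsLocalRing.eq_maximalIdeal (RingHom.ker_isMaximal_of_surjective θ hθ)).le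
      · obtain ⟨a, rfl⟩ := hθ b
        exact ⟨Ideal.Quotient.mk _ a, rfl⟩
    haveI : IsIso (CommRingCat.ofHom (fibreRingHom (maximalIdeal O) θ hI 0)) :=
      (RingEquiv.ofBijective _ hbij).toCommRingCatIso.isIso_hom
    infer_instance
  -- J1 at `n = 0`
  obtain ⟨Y₁, j₁, s₁, hj₁, hj₁flat, hsq₁⟩ := embeddedInfinitesimalLiftFact_holds O k θ hθ W w W₀ jW tW hsq hflat inferInstance Y₀ ι hι hlci
    hH1 0 Y₀ (ι ≫ fibreEmb (maximalIdeal O) w θ hI hsq 0) inferInstance hflat0 ⟨𝟙 Y₀, hs₀⟩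
  haveI := hj₁
  -- `G := 𝓘_{Y₁}`: the kernel form (γ♯) and flatness of `V(G) ≅ Y₁`
  have hGcomap : j₁.ker.comap (infinitesimalNeighbourhood.transition (maximalIdeal O) w 0) =
      (ι ≫ fibreEmb (maximalIdeal O) w θ hI hsq 0).ker := ker_comap_eq_of_isPullback hsq₁
  have hGflat : Flat (j₁.ker.subschemeι ≫ infinitesimalNeighbourhood.toSpec (maximalIdeal O) w (0 + 1)) := by
    have h1 : Flat (j₁.toImage ≫ j₁.ker.subschemeι ≫ infinitesimalNeighbourhood.toSpec (maximalIdeal O) w (0 + 1)) := by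
      rw [← Category.assoc]
      change Flat ((j₁.toImage ≫ j₁.imageι) ≫ _)
      rw [j₁.toImage_imageι]; exact hj₁flat
    exact (MorphismProperty.cancel_left_of_respectsIso @Flat j₁.toImage _).mp h1
  -- the small charts
  have hcharts : ∀ x : infinitesimalNeighbourhood (maximalIdeal O) w (0 + 1),
      ∃ U : (infinitesimalNeighbourhood (maximalIdeal O) w (0 + 1)).affineOpens,
        x ∈ (U : (infinitesimalNeighbourhood (maximalIdeal O) w (0 + 1)).Opens) ∧ HasLciTrace (maximalIdeal O) w 0 θ hθ hI hsq ι U :=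
    exists_affine_hasLciTrace hθ hI hsq ι hlci 0
  refine ⟨j₁.ker, hGcomap, hGflat, fun ψ => ?_⟩
  -- (C3): the twist by `ψ`
  obtain ⟨G', hG'comap, hG'flat, hG'diff⟩ :=
    exists_idealSheafData_twist (hq := hθ) (hI := hI) (hsq := hsq) hs₀ (hkert 0) (hann 0) (hεm 0) (hnil 0) j₁.ker hGcomap hGflat
      hcharts ψ
  refine ⟨G', hG'comap, hG'flat, ?_, hG'diff⟩
  -- the restriction square `Y₀ = V(G') ×_W W₀` along `jW`
  have hle : G'.subschemeι.ker ≤ ((ι ≫ fibreEmb (maximalIdeal O) w θ hI hsq 0) ≫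
      infinitesimalNeighbourhood.transition (maximalIdeal O) w 0).ker := by
    rw [ker_subschemeι, ← map_ker, ← hG'comap]
    exact G'.le_map_comap _
  refine ⟨IsClosedImmersion.lift G'.subschemeι _ hle, ?_⟩
  have hsqB : IsPullback (IsClosedImmersion.lift G'.subschemeι _ hle) (ι ≫ fibreEmb (maximalIdeal O) w θ hI hsq 0) G'.subschemeι
      (infinitesimalNeighbourhood.transition (maximalIdeal O) w 0) :=
    (isPullback_of_isClosedImmersion (ι ≫ fibreEmb (maximalIdeal O) w θ hI hsq 0) G'.subschemeι
      (IsClosedImmersion.lift G'.subschemeι _ hle) (infinitesimalNeighbourhood.transition (maximalIdeal O) w 0)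
      (by rw [IsClosedImmersion.lift_fac]) (by rw [ker_subschemeι, hG'comap])).flip
  have hsqA : IsPullback (𝟙 Y₀) ι (ι ≫ fibreEmb (maximalIdeal O) w θ hI hsq 0) (fibreEmb (maximalIdeal O) w θ hI hsq 0) :=
    isPullback_id_of_mono ι (fibreEmb (maximalIdeal O) w θ hI hsq 0)
  have hsqC : IsPullback (𝟙 G'.subscheme) G'.subschemeι
      (G'.subschemeι ≫ infinitesimalNeighbourhood.ι (maximalIdeal O) w (0 + 1)) (infinitesimalNeighbourhood.ι (maximalIdeal O) w (0 + 1)) :=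
    isPullback_id_of_mono G'.subschemeι (infinitesimalNeighbourhood.ι (maximalIdeal O) w (0 + 1))
  have hsqABC := (hsqA.paste_horiz hsqB).paste_horiz hsqC
  rw [Category.id_comp, Category.comp_id, fibreEmb_transition, fibreEmb_ι] at hsqABC
  exact hsqABC

end Summit.ResolutionOfSingularities.ResolutionOfSingularities.Cruxes.EquisingularLiftNat.Sections

end
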